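import Summits.HubbardSuperconductivity.HubbardSuperconductivity.Theorems.KLProgrammeKLRegimeTwoPointAssemblyMatsubaraClusterIntegral
import HarnessLib

/-!
# Route `KLProgramme`, crux K3, child 4 `KLRegimeTwoPointAssembly`, stub `stub_asm_matsubara` —
# part B: the cluster-integral bound on the time cube, real-variable packaging

Cell gate-hubbard-kl, seat t2 (HOME/t2/MATSUBARA-ALLU-SCOPE.md §2 (e)–(g)).  Part A
(`…MatsubaraClusterIntegral`) proved the iterated-marginal recursion `lmarginal_prod_sum_le` and the Touchard majorant.
Here the two are combined into the statement consumed by the determinant domination of the all-coupling Matsubara limit: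
for a real kernel `0 ≤ w ≤ K₀`, measurable, with `∫₀^β w(c − t) dt ≤ ε₀` for every real `c`, and every `r > 0`,

* **`integral_sum_prod_sum_le`** —
  `∫_{[0,β]^m} Σ_{T ⊆ [m]} ∏_{a∈T} Σ_{b∈[m]} w(τ_b − τ_a) dτ ≤ m! · r^{−m} · e^{βr} · exp((βK₀ + mε₀) · r · e^{βK₀ r})`;
* `integrableOn_sum_prod_sum` — the integrand is integrable on the cube (bounded and measurable).

Only bookkeeping between the Bochner integral on `Set.Icc 0 β` (as used by the tree's Matsubara files) and Mathlib's
`lmarginal`/`lintegral` over the product of restricted Lebesgue measures; no new idea.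
-/

namespace Summit.HubbardSuperconductivity.HubbardSuperconductivity.Theorems.MatsubaraAllU

set_option linter.dupNamespace false -- summit = problem name (single-conjunct summit), D-0017

open MeasureTheory Finset
open scoped ENNReal Nat

noncomputable section

variable {m : ℕ}

/-- The real cluster sum `τ ↦ Σ_T ∏_{a∈T} Σ_b w(τ_b − τ_a)` is measurable. -/
theorem measurable_sum_prod_sum (wr : ℝ → ℝ) (hw : Measurable wr) :
    Measurable fun τ : Fin m → ℝ => ∑ T : Finset (Fin m), ∏ a ∈ T, ∑ b : Fin m, wr (τ b - τ a) := by
  refine Finset.measurable_sum _ fun T _ => Finset.measurable_prod T fun a _ =>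
    Finset.measurable_sum _ fun b _ => ?_
  exact hw.comp ((measurable_pi_apply b).sub (measurable_pi_apply a))

/-- Pointwise bound of the real cluster sum: `0 ≤ Σ_T ∏ Σ w ≤ 2^m (m K₀ + 1)^m`. -/
theorem sum_prod_sum_nonneg_le (wr : ℝ → ℝ) (hw0 : ∀ s, 0 ≤ wr s) (K₀ : ℝ) (hK : ∀ s, wr s ≤ K₀)
    (τ : Fin m → ℝ) :
    0 ≤ ∑ T : Finset (Fin m), ∏ a ∈ T, ∑ b : Fin m, wr (τ b - τ a) ∧
      ∑ T : Finset (Fin m), ∏ a ∈ T, ∑ b : Fin m, wr (τ b - τ a) ≤ 2 ^ m * ((m : ℝ) * K₀ + 1) ^ m := by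
  have hsum : ∀ a, 0 ≤ ∑ b : Fin m, wr (τ b - τ a) := fun a => Finset.sum_nonneg fun b _ => hw0 _
  have hsumle : ∀ a, ∑ b : Fin m, wr (τ b - τ a) ≤ (m : ℝ) * K₀ + 1 := fun a => by
    calc ∑ b : Fin m, wr (τ b - τ a) ≤ ∑ _b : Fin m, K₀ := Finset.sum_le_sum fun b _ => hK _
      _ = (m : ℝ) * K₀ := by rw [Finset.sum_const, Finset.card_univ, Fintype.card_fin, nsmul_eq_mul]
      _ ≤ (m : ℝ) * K₀ + 1 := by linarith
  have h1 : (1 : ℝ) ≤ (m : ℝ) * K₀ + 1 := by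
    have : (0 : ℝ) ≤ (m : ℝ) * K₀ := by
      rcases Nat.eq_zero_or_pos m with hm | hm
      · simp [hm]
      · have hK0 : 0 ≤ K₀ := (hw0 0).trans (hK 0)
        positivity
    linarith
  refine ⟨Finset.sum_nonneg fun T _ => Finset.prod_nonneg fun a _ => hsum a, ?_⟩
  calc ∑ T : Finset (Fin m), ∏ a ∈ T, ∑ b : Fin m, wr (τ b - τ a)
      ≤ ∑ _T : Finset (Fin m), ((m : ℝ) * K₀ + 1) ^ m := by
        refine Finset.sum_le_sum fun T _ => ?_
        calc ∏ a ∈ T, ∑ b : Fin m, wr (τ b - τ a) ≤ ∏ _a ∈ T, ((m : ℝ) * K₀ + 1) :=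
              Finset.prod_le_prod (fun a _ => hsum a) fun a _ => hsumle a
          _ = ((m : ℝ) * K₀ + 1) ^ T.card := Finset.prod_const _
          _ ≤ ((m : ℝ) * K₀ + 1) ^ m :=
              pow_le_pow_right₀ h1 ((card_le_univ T).trans_eq (Fintype.card_fin m))
    _ = 2 ^ m * ((m : ℝ) * K₀ + 1) ^ m := by
        rw [Finset.sum_const, Finset.card_univ, Fintype.card_finset, Fintype.card_fin, nsmul_eq_mul]
        push_cast
        ring

/-- The real cluster sum is integrable on the time cube `[0,β]^m`. -/
theorem integrableOn_sum_prod_sum (β : ℝ) (wr : ℝ → ℝ) (hw : Measurable wr) (hw0 : ∀ s, 0 ≤ wr s) (K₀ : ℝ)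
    (hK : ∀ s, wr s ≤ K₀) :
    IntegrableOn (fun τ : Fin m → ℝ => ∑ T : Finset (Fin m), ∏ a ∈ T, ∑ b : Fin m, wr (τ b - τ a))
      (Set.Icc (0 : Fin m → ℝ) (fun _ => β)) volume := by
  refine Measure.integrableOn_of_bounded (M := 2 ^ m * ((m : ℝ) * K₀ + 1) ^ m) ?_
    (measurable_sum_prod_sum wr hw).aestronglyMeasurable (ae_of_all _ fun τ => ?_)
  · rw [Real.volume_Icc_pi]
    exact ENNReal.prod_ne_top fun _ _ => ENNReal.ofReal_ne_top
  · obtain ⟨h0, h1⟩ := sum_prod_sum_nonneg_le wr hw0 K₀ hK τ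
    rw [Real.norm_of_nonneg h0]
    exact h1

/-- **The cluster-integral bound on the time cube** (real-variable form).  For a measurable kernel `0 ≤ w ≤ K₀` with
`∫₀^β w(c − t) dt ≤ ε₀` for every real `c` (`β, K₀, ε₀ ≥ 0`) and every `r > 0`:
`∫_{[0,β]^m} Σ_{T⊆[m]} ∏_{a∈T} Σ_{b∈[m]} w(τ_b − τ_a) dτ ≤ m!·r^{−m}·e^{βr}·exp((βK₀ + mε₀)·r·e^{βK₀ r})`.
(Iterated-marginal recursion `lmarginal_prod_sum_le` with the Touchard majorant `touchard_step`, summed by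
`touchard_total`.)  After division by `m!` the right-hand side is geometric in `m` with ratio `≈ e^{ε₀ r e^{βK₀r}}/r`. -/
theorem integral_sum_prod_sum_le (β : ℝ) (hβ : 0 ≤ β) (wr : ℝ → ℝ) (hw : Measurable wr)
    (hw0 : ∀ s, 0 ≤ wr s) (K₀ ε₀ : ℝ) (hK₀ : 0 ≤ K₀) (hε₀ : 0 ≤ ε₀) (hK : ∀ s, wr s ≤ K₀)
    (hε : ∀ c : ℝ, ∫ t in Set.Icc (0 : ℝ) β, wr (c - t) ≤ ε₀) (r : ℝ) (hr : 0 < r) :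
    ∫ τ in Set.Icc (0 : Fin m → ℝ) (fun _ => β), ∑ T : Finset (Fin m), ∏ a ∈ T, ∑ b : Fin m, wr (τ b - τ a) ≤
      (m ! : ℝ) / r ^ m * Real.exp (β * r) * Real.exp ((β * K₀ + m * ε₀) * r * Real.exp (β * K₀ * r)) := by
  classical
  -- the `ℝ≥0∞`-valued kernel and its data
  set w : ℝ → ℝ≥0∞ := fun s => ENNReal.ofReal (wr s) with hwdef
  have hwm : Measurable w := ENNReal.measurable_ofReal.comp hw
  have hKw : ∀ s, w s ≤ ENNReal.ofReal K₀ := fun s => ENNReal.ofReal_le_ofReal (hK s)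
  have hεw : ∀ c : ℝ, ∫⁻ t in Set.Icc (0 : ℝ) β, w (c - t) ≤ ENNReal.ofReal ε₀ := by
    intro c
    have hmeas : Measurable fun t : ℝ => wr (c - t) := hw.comp (measurable_const.sub measurable_id)
    have hint : IntegrableOn (fun t : ℝ => wr (c - t)) (Set.Icc (0 : ℝ) β) volume :=
      Measure.integrableOn_of_bounded (M := K₀) (by rw [Real.volume_Icc]; exact ENNReal.ofReal_ne_top)
        hmeas.aestronglyMeasurable (ae_of_all _ fun t => by
          rw [Real.norm_of_nonneg (hw0 _)]; exact hK _)
    rw [hwdef, ← ofReal_integral_eq_lintegral_ofReal hint (ae_of_all _ fun t => hw0 _)]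
    exact ENNReal.ofReal_le_ofReal (hε c)
  -- the Touchard majorant, real and `ℝ≥0∞`
  set c₀ : ℝ := β * K₀ + m * ε₀ with hc₀
  have hc₀0 : 0 ≤ c₀ := by positivity
  set y : ℝ := c₀ * r * Real.exp (β * K₀ * r) with hy
  have hy0 : 0 ≤ y := by positivity
  set Ar : ℕ → ℝ := fun t => (t ! : ℝ) / r ^ t * ∑ j ∈ range (t + 1), y ^ j / (j ! : ℝ) with hAr
  have hAr0 : ∀ t, 0 ≤ Ar t := fun t => mul_nonneg (by positivity) (Finset.sum_nonneg fun _ _ => by positivity)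
  set A : ℕ → ℝ≥0∞ := fun t => ENNReal.ofReal (Ar t) with hA
  have hA0 : 1 ≤ A 0 := by
    simp only [hA, hAr, Nat.factorial_zero, Nat.cast_one, pow_zero, div_one, one_mul, zero_add,
      Finset.sum_range_one, ENNReal.ofReal_one, le_refl]
  have hArec : ∀ s : ℕ, (ENNReal.ofReal β * ENNReal.ofReal K₀ + m * ENNReal.ofReal ε₀) *
      ∑ t ∈ range (s + 1), ((s.choose t : ℕ) : ℝ≥0∞) * (ENNReal.ofReal β * ENNReal.ofReal K₀) ^ t * A (s - t) ≤
      A (s + 1) := by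
    intro s
    have hstep := touchard_step c₀ (β * K₀) r hc₀0 (by positivity) hr s
    have hlhs : (ENNReal.ofReal β * ENNReal.ofReal K₀ + m * ENNReal.ofReal ε₀) *
        ∑ t ∈ range (s + 1), ((s.choose t : ℕ) : ℝ≥0∞) * (ENNReal.ofReal β * ENNReal.ofReal K₀) ^ t * A (s - t) =
        ENNReal.ofReal (c₀ * ∑ t ∈ range (s + 1), (s.choose t : ℝ) * (β * K₀) ^ t * Ar (s - t)) := by
      rw [← ENNReal.ofReal_mul hβ, ← ENNReal.ofReal_natCast m, ← ENNReal.ofReal_mul (Nat.cast_nonneg m),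
        ← ENNReal.ofReal_add (by positivity) (by positivity), ENNReal.ofReal_mul hc₀0,
        ENNReal.ofReal_sum_of_nonneg (fun t _ => mul_nonneg (mul_nonneg (Nat.cast_nonneg _)
          (pow_nonneg (by positivity) _)) (hAr0 _))]
      congr 1
      refine Finset.sum_congr rfl fun t _ => ?_
      rw [ENNReal.ofReal_mul (mul_nonneg (Nat.cast_nonneg _) (pow_nonneg (by positivity) _)),
        ENNReal.ofReal_mul (Nat.cast_nonneg _), ENNReal.ofReal_natCast, ENNReal.ofReal_pow (by positivity)]
    rw [hlhs]
    exact ENNReal.ofReal_le_ofReal hstep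
  -- the integrand in `ℝ≥0∞`
  set F : (Fin m → ℝ) → ℝ := fun τ => ∑ T : Finset (Fin m), ∏ a ∈ T, ∑ b : Fin m, wr (τ b - τ a) with hF
  have hFm : Measurable F := measurable_sum_prod_sum wr hw
  have hF0 : ∀ τ, 0 ≤ F τ := fun τ => (sum_prod_sum_nonneg_le wr hw0 K₀ hK τ).1
  have hofF : ∀ τ, ENNReal.ofReal (F τ) = ∑ T : Finset (Fin m), ∏ a ∈ T, ∑ b : Fin m, w (τ b - τ a) := by
    intro τ
    rw [hF]
    simp only
    rw [ENNReal.ofReal_sum_of_nonneg (fun T _ => Finset.prod_nonneg fun a _ =>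
      Finset.sum_nonneg fun b _ => hw0 _)]
    refine Finset.sum_congr rfl fun T _ => ?_
    rw [ENNReal.ofReal_prod_of_nonneg (fun a _ => Finset.sum_nonneg fun b _ => hw0 _)]
    refine Finset.prod_congr rfl fun a _ => ?_
    rw [ENNReal.ofReal_sum_of_nonneg (fun b _ => hw0 _)]
  -- the lintegral over the cube is an iterated marginal over all coordinates
  have hcube : (volume : Measure (Fin m → ℝ)).restrict (Set.Icc (0 : Fin m → ℝ) (fun _ => β)) =
      Measure.pi (fun _ : Fin m => (volume : Measure ℝ).restrict (Set.Icc (0 : ℝ) β)) := by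
    rw [MeasureTheory.volume_pi, ← Measure.restrict_pi_pi]
    congr 1
    rw [← Set.pi_univ_Icc]
    rfl
  have hlint : ∫⁻ τ in Set.Icc (0 : Fin m → ℝ) (fun _ => β), ENNReal.ofReal (F τ) ≤
      ENNReal.ofReal ((m ! : ℝ) / r ^ m * Real.exp (β * r) * Real.exp y) := by
    rw [hcube]
    simp_rw [hofF]
    rw [lintegral_eq_lmarginal_univ (0 : Fin m → ℝ),
      lmarginal_finset_sum' _ _ (fun T _ => measurable_prod_sum_kernel w hwm T)]
    calc ∑ T : Finset (Fin m), (∫⋯∫⁻_univ, (fun τ => ∏ a ∈ T, ∑ b : Fin m, w (τ b - τ a))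
            ∂(fun _ : Fin m => (volume : Measure ℝ).restrict (Set.Icc (0 : ℝ) β))) 0
        ≤ ∑ T : Finset (Fin m), ENNReal.ofReal β ^ ((univ : Finset (Fin m)).card - T.card) * A T.card :=
          Finset.sum_le_sum fun T _ =>
            lmarginal_prod_sum_le β w hwm (ENNReal.ofReal K₀) (ENNReal.ofReal ε₀) hKw hεw A hA0 hArec
              univ T (subset_univ T) 0
      _ = ∑ t ∈ range (m + 1), ((m.choose t : ℕ) : ℝ≥0∞) * (ENNReal.ofReal β ^ (m - t) * A t) := by
          rw [← Finset.powerset_univ, Finset.sum_powerset_apply_card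
            (fun t => ENNReal.ofReal β ^ ((univ : Finset (Fin m)).card - t) * A t)]
          simp only [Finset.card_univ, Fintype.card_fin, nsmul_eq_mul]
      _ = ENNReal.ofReal (∑ t ∈ range (m + 1), (m.choose t : ℝ) * β ^ (m - t) * Ar t) := by
          rw [ENNReal.ofReal_sum_of_nonneg (fun t _ => mul_nonneg (mul_nonneg (Nat.cast_nonneg _)
            (pow_nonneg hβ _)) (hAr0 _))]
          refine Finset.sum_congr rfl fun t _ => ?_
          rw [ENNReal.ofReal_mul (mul_nonneg (Nat.cast_nonneg _) (pow_nonneg hβ _)),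
            ENNReal.ofReal_mul (Nat.cast_nonneg _), ENNReal.ofReal_natCast, ENNReal.ofReal_pow hβ, mul_assoc]
      _ ≤ ENNReal.ofReal ((m ! : ℝ) / r ^ m * Real.exp (β * r) * Real.exp y) :=
          ENNReal.ofReal_le_ofReal (touchard_total β y r hβ hy0 hr m)
  -- back to the Bochner integral
  have hRHS0 : 0 ≤ (m ! : ℝ) / r ^ m * Real.exp (β * r) * Real.exp y := by positivity
  rw [integral_eq_lintegral_of_nonneg_ae (ae_of_all _ fun τ => hF0 τ) hFm.aestronglyMeasurable]
  exact ENNReal.toReal_le_of_le_ofReal hRHS0 hlint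

end

end Summit.HubbardSuperconductivity.HubbardSuperconductivity.Theorems.MatsubaraAllU
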